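import Literature.AnabelianGeometry.EtaleTheta.Discharge.Sec3Cor38iiWeak
import Literature.AnabelianGeometry.EtaleTheta.Discharge.Sec3Cor38RowsAssembly
import Literature.AnabelianGeometry.EtaleTheta.Discharge.Sec3BLambdaInjectiveOfGaloisCoveringConnected
import Literature.AnabelianGeometry.EtaleTheta.TemperedFrobenioidOfGaloisCoveringRankOnePointR
import Literature.AnabelianGeometry.SemiGraphs.CosetCategoriesSlimTempered
import Literature.AlgebraicGeometry.Frobenioids.DivisorMonoidCategoryTheoreticityCorSchemaNegative
import HarnessLib

/-!
# [EtTh] Cor. 3.8, proof rows C38-L04 (case (ii)) / L07 / L07b / L09 — `BaseSquare` (F-2813), `BaseSquareInv` (F-2814),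
# `PreservesFactorisation` (F-2818), `BsFldOfFactorisation` (F-2819), `PreservesFrobeniusTrivial` (F-2821) — AT THE GENUINE
# CARRIERS, part B (D-0079 L-F [EtTh]; seat abc-iut-w5-d246; PROOF-ONLY, 0 `def`; sequel of `Sec3Cor38RowsGenuineCarriersWeak.lean`)

Mochizuki, *The étale theta function and its Frobenioid-theoretic manifestations*, Publ. RIMS **45** (2009), Cor. 3.8 and
its proof, PDF pp. 80–82 [cite: MochizukiEtTh2009, Cor 3.8 p.81]: «[Mzk17], Corollary 4.11, (ii), in the case of assertion
(ii) … `Ψ` preserves [cf. [Mzk17], Theorem 3.4, (ii), (iii)] the factorization … into a composite of a morphism of Frobenius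
type, a pre-step, and a pull-back morphism»; p.82 l.1 «`Ψ` preserves … the Frobenius-trivial objects».

As in part A, the five rows are SCHEMATA over arbitrary tempered-Frobenioid data; the cell's closers of record hold MODULO
ONLY `hF_i :` «`C_i` is a Frobenioid» (+ «`D_i` Div-slim» for the Cor. 4.11 (ii) rows): `Cor38Hyp.baseSquare_of_isFrobenioid_weak`,
`baseSquareInv_of_isFrobenioid_weak`, `preservesFrobeniusTrivial_of_isFrobenioid_of_isDivSlim_weak` (abc-iut-L2-d2 / w6-d040
lineage, `Sec3Cor38iiWeak.lean`), `preservesFactorisation_of_isFrobenioid` (fed with the tree's THEOREM `FrdI.Thm34ii_holds`,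
`Sec3Cor38RowsAssembly.lean`), `TemperedFrobenioid.bsFldOfFactorisation_of_isFrobenioid` (`Sec3Cor38Rows.lean`); and «`C` IS
a Frobenioid» is a THEOREM at the constructed data (abc-iut-w6-d048 lineage).  This file composes them at the same three
carrier classes as part A — complementing abc-iut-w6-d053's `Sec3Cor38SubPredicatesAtTateTower.lean` (F-2813/2814/2821 as
conjuncts at the monoid-type-`ℤ` rank-one-point models):

* §1 — GENUINE BASE `B^temp(Π)⁰`, EVERY pair of tempered Frobenioids of monoid type `ℝ` over the weak constructed data of the
  connected coverings: F-2818 with NO Prop binder; F-2819 for EVERY SINGLE such tempered Frobenioid (no `h` at all); F-2813 /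
  F-2814 / F-2821 under print's «`D_i` Div-slim», supplied as «`Π_i` tempered and temp-slim» ([SemiAnbd] Rmk. 3.4.1 ⇒ slim ⇒
  Div-slim, [FrdI] Def. 4.5 (iv)).
* §2 — bases of FSM-type: F-2818 / F-2819 modulo `IsOfFSMType D_i` only.
* §3 — the monoid-type-`ℝ` model of record `TateTowerFrd.temperedFrobenioidR R S`: all five with NO binder (one-point base
  ⇒ Div-slim, `PreFrobenioidData.CorSchemaNegative.isDivSlim_of_subsingleton`).
NOT taken: F-2811 `CompatibleWithPerfection` (typed stronger than print, refuted as typed; its repaired form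
`CompatibleWithPerfectionR` is stated over the strong tree monoid vocabulary only); F-2808 `StandardIsotropicNotGroupLike`
already holds UNIVERSALLY over the weak vocabulary (`forall_standardIsotropicNotGroupLike_treeMonoidVocabWeak`).

Honest framing: refereed pre-IUT material; «PROVED» = OUR kernel check of OUR typed instance form; the constructed data are the
cell's models of the Def. 3.3/3.6 structures, not an étale theta function of an actual curve; nothing here bears on, or takes a
side on, [IUTchIII] Cor. 3.12; typed ≠ proved for the schema rows themselves.
-/

noncomputable section

namespace Literature.AnabelianGeometry.EtaleTheta

open CategoryTheory Opposite Literature.AlgebraicGeometry.Frobenioids Literature.AnabelianGeometry.SemiGraphs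
  LogDivisorModel.GaloisAction

universe u u' v' uG

/-! ## §1. The genuine base `B^temp(Π)⁰`, monoid type `ℝ`, weak constructed data -/

section GenuineBase

variable {Z : LogDivisorModel.{u}} {G : Type u} [Group G] {A : Z.GaloisAction G} {hZ : Z.CuspLaws}
  {hpf : ∀ Y : ((isConnectedGSet (G := G)).FullSubcategory)ᵒᵖ,
    IsPerfFactorialCof ((DivisorMonoids.ofGaloisActionConnected A hZ).Φ₀.obj Y)}
  {Z' : LogDivisorModel.{u}} {G' : Type u} [Group G'] {A' : Z'.GaloisAction G'} {hZ' : Z'.CuspLaws}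
  {hpf' : ∀ Y : ((isConnectedGSet (G := G')).FullSubcategory)ᵒᵖ,
    IsPerfFactorialCof ((DivisorMonoids.ofGaloisActionConnected A' hZ').Φ₀.obj Y)}
  {P : Type uG} [Group P] [TopologicalSpace P] {P' : Type uG} [Group P'] [TopologicalSpace P']
  {IsRational IsStrictlyRational : ((ConnectedPart (BTemp P))ᵒᵖ ⥤ CommMonCat.{u}) → Prop}
  {IsRational' IsStrictlyRational' : ((ConnectedPart (BTemp P'))ᵒᵖ ⥤ CommMonCat.{u}) → Prop}
  {C₁ : TemperedFrobenioid (RealifiedDivisorMonoids.ofRlfRWeak (DivisorMonoids.ofGaloisActionConnected A hZ) hpf)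
    (ConnectedPart (BTemp P)) (treeCatVocab (ConnectedPart (BTemp P)) IsRational IsStrictlyRational)}
  {C₂ : TemperedFrobenioid (RealifiedDivisorMonoids.ofRlfRWeak (DivisorMonoids.ofGaloisActionConnected A' hZ') hpf')
    (ConnectedPart (BTemp P')) (treeCatVocab (ConnectedPart (BTemp P')) IsRational' IsStrictlyRational')}

/-- **F-2819 / C38-L07b for EVERY tempered Frobenioid of monoid type `ℝ` over the weak constructed data at the genuine base
`B^temp(Π)⁰`, NO binder at all** (no Cor. 3.8 datum needed): in a factorisation `f = F ≫ φ ≫ λ` (Frobenius type · pre-step ·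
pull-back) `f` is base-field-theoretic iff `φ` is. [cite: MochizukiEtTh2009, Cor 3.8 p.81] -/
theorem TemperedFrobenioid.bsFldOfFactorisation_ofRlfRWeak_connectedPart_bTemp (C₁ : TemperedFrobenioid
    (RealifiedDivisorMonoids.ofRlfRWeak (DivisorMonoids.ofGaloisActionConnected A hZ) hpf)
    (ConnectedPart (BTemp P)) (treeCatVocab (ConnectedPart (BTemp P)) IsRational IsStrictlyRational)) :
    Literature.AnabelianGeometry.EtaleTheta.TemperedFrobenioid.BsFldOfFactorisation C₁ :=
  C₁.bsFldOfFactorisation_of_isFrobenioid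
    (TemperedFrobenioid.isFrobenioid_ofRlfRWeak_ofGaloisActionConnected_connectedPart_bTemp A hZ hpf C₁)

namespace Cor38Hyp

variable (h : Cor38Hyp C₁ C₂)

/-- **F-2818 / C38-L07 at the genuine base `B^temp(Π)⁰`, NO Prop binder**: `Ψ` and `Ψ⁻¹` preserve pre-steps, morphisms of
Frobenius type and pull-back morphisms ([FrdI] Thm. 3.4 (ii), (iii) — the tree's `FrdI.Thm34ii_holds` — with C38-L01
unconditional over the weak vocabulary). [cite: MochizukiEtTh2009, Cor 3.8 p.81] -/
theorem preservesFactorisation_ofRlfRWeak_connectedPart_bTemp :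
    Literature.AnabelianGeometry.EtaleTheta.Cor38Hyp.PreservesFactorisation h :=
  h.preservesFactorisation_of_isFrobenioid FrdI.Thm34ii_holds
    (TemperedFrobenioid.isFrobenioid_ofRlfRWeak_ofGaloisActionConnected_connectedPart_bTemp A hZ hpf C₁)
    (TemperedFrobenioid.isFrobenioid_ofRlfRWeak_ofGaloisActionConnected_connectedPart_bTemp A' hZ' hpf' C₂)
    h.standardIsotropicNotGroupLike_treeMonoidVocabWeak

variable [IsTopologicalGroup P] [IsTopologicalGroup P']

/-- **F-2813 at the genuine base `B^temp(Π)⁰`** ([FrdI] Cor. 4.11 (ii) for `Ψ`: a `1`-unique base square `Ψ^Base`), under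
print's hypothesis «`D_i` Div-slim» supplied as «`Π_i` tempered and temp-slim». [cite: MochizukiEtTh2009, Cor 3.8 p.81] -/
theorem baseSquare_ofRlfRWeak_connectedPart_bTemp (hG : IsTempered P) (hS : IsSlimGroup P) (hG' : IsTempered P')
    (hS' : IsSlimGroup P') :
    Literature.AnabelianGeometry.EtaleTheta.Cor38Hyp.BaseSquare h :=
  h.baseSquare_of_isFrobenioid_weak
    (TemperedFrobenioid.isFrobenioid_ofRlfRWeak_ofGaloisActionConnected_connectedPart_bTemp A hZ hpf C₁)
    (TemperedFrobenioid.isFrobenioid_ofRlfRWeak_ofGaloisActionConnected_connectedPart_bTemp A' hZ' hpf' C₂)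
    ⟨C₁.opsData.isDivSlim_of_isSlim (isSlim_connectedPart_bTemp hG hS),
      C₂.opsData.isDivSlim_of_isSlim (isSlim_connectedPart_bTemp hG' hS')⟩

/-- **F-2814 at the genuine base `B^temp(Π)⁰`** (Cor. 4.11 (ii) for `Ψ⁻¹`), same hypotheses.
[cite: MochizukiEtTh2009, Cor 3.8 p.81] -/
theorem baseSquareInv_ofRlfRWeak_connectedPart_bTemp (hG : IsTempered P) (hS : IsSlimGroup P) (hG' : IsTempered P')
    (hS' : IsSlimGroup P') :
    Literature.AnabelianGeometry.EtaleTheta.Cor38Hyp.BaseSquareInv h :=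
  h.baseSquareInv_of_isFrobenioid_weak
    (TemperedFrobenioid.isFrobenioid_ofRlfRWeak_ofGaloisActionConnected_connectedPart_bTemp A hZ hpf C₁)
    (TemperedFrobenioid.isFrobenioid_ofRlfRWeak_ofGaloisActionConnected_connectedPart_bTemp A' hZ' hpf' C₂)
    ⟨C₁.opsData.isDivSlim_of_isSlim (isSlim_connectedPart_bTemp hG hS),
      C₂.opsData.isDivSlim_of_isSlim (isSlim_connectedPart_bTemp hG' hS')⟩

/-- **F-2821 / C38-L09 at the genuine base `B^temp(Π)⁰`** (p.82 l.1: `Ψ`, `Ψ⁻¹` preserve the Frobenius-trivial objects),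
same hypotheses. [cite: MochizukiEtTh2009, Cor 3.8 p.82] -/
theorem preservesFrobeniusTrivial_ofRlfRWeak_connectedPart_bTemp (hG : IsTempered P) (hS : IsSlimGroup P)
    (hG' : IsTempered P') (hS' : IsSlimGroup P') :
    Literature.AnabelianGeometry.EtaleTheta.Cor38Hyp.PreservesFrobeniusTrivial h :=
  h.preservesFrobeniusTrivial_of_isFrobenioid_of_isDivSlim_weak
    (TemperedFrobenioid.isFrobenioid_ofRlfRWeak_ofGaloisActionConnected_connectedPart_bTemp A hZ hpf C₁)
    (TemperedFrobenioid.isFrobenioid_ofRlfRWeak_ofGaloisActionConnected_connectedPart_bTemp A' hZ' hpf' C₂)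
    ⟨C₁.opsData.isDivSlim_of_isSlim (isSlim_connectedPart_bTemp hG hS),
      C₂.opsData.isDivSlim_of_isSlim (isSlim_connectedPart_bTemp hG' hS')⟩

end Cor38Hyp

end GenuineBase

/-! ## §2. Bases of FSM-type, monoid type `ℝ`, weak constructed data — modulo `IsOfFSMType D_i` only -/

section FSMBase

variable {Z : LogDivisorModel.{u}} {G : Type u} [Group G] {A : Z.GaloisAction G} {hZ : Z.CuspLaws}
  {hpf : ∀ Y : ((isConnectedGSet (G := G)).FullSubcategory)ᵒᵖ,
    IsPerfFactorialCof ((DivisorMonoids.ofGaloisActionConnected A hZ).Φ₀.obj Y)}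
  {Z' : LogDivisorModel.{u}} {G' : Type u} [Group G'] {A' : Z'.GaloisAction G'} {hZ' : Z'.CuspLaws}
  {hpf' : ∀ Y : ((isConnectedGSet (G := G')).FullSubcategory)ᵒᵖ,
    IsPerfFactorialCof ((DivisorMonoids.ofGaloisActionConnected A' hZ').Φ₀.obj Y)}
  {D : Type u'} [Category.{v'} D] {D' : Type u'} [Category.{v'} D']
  {IsRational IsStrictlyRational : (Dᵒᵖ ⥤ CommMonCat.{u}) → Prop}
  {IsRational' IsStrictlyRational' : (D'ᵒᵖ ⥤ CommMonCat.{u}) → Prop}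
  {C₁ : TemperedFrobenioid (RealifiedDivisorMonoids.ofRlfRWeak (DivisorMonoids.ofGaloisActionConnected A hZ) hpf) D
    (treeCatVocab D IsRational IsStrictlyRational)}
  {C₂ : TemperedFrobenioid (RealifiedDivisorMonoids.ofRlfRWeak (DivisorMonoids.ofGaloisActionConnected A' hZ') hpf') D'
    (treeCatVocab D' IsRational' IsStrictlyRational')}

/-- **F-2819 over a base of FSM-type**, modulo `IsOfFSMType D` only. [cite: MochizukiEtTh2009, Cor 3.8 p.81] -/
theorem TemperedFrobenioid.bsFldOfFactorisation_ofRlfRWeak_of_isOfFSMType (C₁ : TemperedFrobenioid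
    (RealifiedDivisorMonoids.ofRlfRWeak (DivisorMonoids.ofGaloisActionConnected A hZ) hpf) D
    (treeCatVocab D IsRational IsStrictlyRational)) (hD : IsOfFSMType D) :
    Literature.AnabelianGeometry.EtaleTheta.TemperedFrobenioid.BsFldOfFactorisation C₁ :=
  C₁.bsFldOfFactorisation_of_isFrobenioid
    (TemperedFrobenioid.isFrobenioid_ofRlfRWeak_ofGaloisActionConnected_of_isOfFSMType A hZ hpf C₁ hD)

/-- **F-2818 over bases of FSM-type**, modulo `IsOfFSMType D_i` only. [cite: MochizukiEtTh2009, Cor 3.8 p.81] -/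
theorem Cor38Hyp.preservesFactorisation_ofRlfRWeak_of_isOfFSMType (h : Cor38Hyp C₁ C₂) (hD : IsOfFSMType D)
    (hD' : IsOfFSMType D') :
    Literature.AnabelianGeometry.EtaleTheta.Cor38Hyp.PreservesFactorisation h :=
  h.preservesFactorisation_of_isFrobenioid FrdI.Thm34ii_holds
    (TemperedFrobenioid.isFrobenioid_ofRlfRWeak_ofGaloisActionConnected_of_isOfFSMType A hZ hpf C₁ hD)
    (TemperedFrobenioid.isFrobenioid_ofRlfRWeak_ofGaloisActionConnected_of_isOfFSMType A' hZ' hpf' C₂ hD')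
    h.standardIsotropicNotGroupLike_treeMonoidVocabWeak

end FSMBase

/-! ## §3. The model of record, monoid type `ℝ` (`TateTowerFrd.temperedFrobenioidR`) — all five binder-free -/

section TateTower

variable (R S R' S' : ((Discrete PUnit.{1})ᵒᵖ ⥤ CommMonCat.{0}) → Prop)

/-- **F-2819 at the Tate tower (`Λ = ℝ`), NO binder.** [cite: MochizukiEtTh2009, Cor 3.8 p.81] -/
theorem TateTowerFrd.bsFldOfFactorisation_temperedFrobenioidR :
    Literature.AnabelianGeometry.EtaleTheta.TemperedFrobenioid.BsFldOfFactorisation (TateTowerFrd.temperedFrobenioidR R S) :=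
  (TateTowerFrd.temperedFrobenioidR R S).bsFldOfFactorisation_of_isFrobenioid
    (TateTowerFrd.isFrobenioid_temperedFrobenioidR_byName R S)

variable (h : Cor38Hyp (TateTowerFrd.temperedFrobenioidR R S) (TateTowerFrd.temperedFrobenioidR R' S'))

/-- **F-2818 at the Tate tower (`Λ = ℝ`), NO binder.** [cite: MochizukiEtTh2009, Cor 3.8 p.81] -/
theorem Cor38Hyp.preservesFactorisation_tateTowerR :
    Literature.AnabelianGeometry.EtaleTheta.Cor38Hyp.PreservesFactorisation h :=
  h.preservesFactorisation_of_isFrobenioid FrdI.Thm34ii_holds (TateTowerFrd.isFrobenioid_temperedFrobenioidR_byName R S)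
    (TateTowerFrd.isFrobenioid_temperedFrobenioidR_byName R' S') h.standardIsotropicNotGroupLike_treeMonoidVocabWeak

/-- **F-2813 at the Tate tower (`Λ = ℝ`), NO binder** (one-point base ⇒ Div-slim). [cite: MochizukiEtTh2009, Cor 3.8 p.81] -/
theorem Cor38Hyp.baseSquare_tateTowerR :
    Literature.AnabelianGeometry.EtaleTheta.Cor38Hyp.BaseSquare h :=
  h.baseSquare_of_isFrobenioid_weak (TateTowerFrd.isFrobenioid_temperedFrobenioidR_byName R S)
    (TateTowerFrd.isFrobenioid_temperedFrobenioidR_byName R' S')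
    ⟨PreFrobenioidData.CorSchemaNegative.isDivSlim_of_subsingleton _ (fun _ _ => inferInstance),
      PreFrobenioidData.CorSchemaNegative.isDivSlim_of_subsingleton _ (fun _ _ => inferInstance)⟩

/-- **F-2814 at the Tate tower (`Λ = ℝ`), NO binder.** [cite: MochizukiEtTh2009, Cor 3.8 p.81] -/
theorem Cor38Hyp.baseSquareInv_tateTowerR :
    Literature.AnabelianGeometry.EtaleTheta.Cor38Hyp.BaseSquareInv h :=
  h.baseSquareInv_of_isFrobenioid_weak (TateTowerFrd.isFrobenioid_temperedFrobenioidR_byName R S)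
    (TateTowerFrd.isFrobenioid_temperedFrobenioidR_byName R' S')
    ⟨PreFrobenioidData.CorSchemaNegative.isDivSlim_of_subsingleton _ (fun _ _ => inferInstance),
      PreFrobenioidData.CorSchemaNegative.isDivSlim_of_subsingleton _ (fun _ _ => inferInstance)⟩

/-- **F-2821 at the Tate tower (`Λ = ℝ`), NO binder.** [cite: MochizukiEtTh2009, Cor 3.8 p.82] -/
theorem Cor38Hyp.preservesFrobeniusTrivial_tateTowerR :
    Literature.AnabelianGeometry.EtaleTheta.Cor38Hyp.PreservesFrobeniusTrivial h :=
  h.preservesFrobeniusTrivial_of_isFrobenioid_of_isDivSlim_weak (TateTowerFrd.isFrobenioid_temperedFrobenioidR_byName R S)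
    (TateTowerFrd.isFrobenioid_temperedFrobenioidR_byName R' S')
    ⟨PreFrobenioidData.CorSchemaNegative.isDivSlim_of_subsingleton _ (fun _ _ => inferInstance),
      PreFrobenioidData.CorSchemaNegative.isDivSlim_of_subsingleton _ (fun _ _ => inferInstance)⟩

end TateTower

end Literature.AnabelianGeometry.EtaleTheta

end
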